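import Mathlib
import Summits.Ventures.PercRepro2.TB14FoldPendant

/-!
# The pendant rule for typed BHK 1.4 (single-vertex), mark `b`: a leaf `b` at `u` reduces to `u`
(blind cell PercRepro2, mine-c g13, 2026-08-25; MINE-C.md §22; the pendant map of row 2′TB, `b` side)

If `b` has a single edge `e₁ = {u, b}` and `e₁` is free, then the folded (TB14) count for the
mark `b` at `(F, z)` equals the folded count for the mark `u` at `(F ∖ {e₁}, z[e₁ ↦ closed])`:
the first copies with `e₁` closed contribute nothing (`b ∉ C₁`), and closing `e₁` in a first copy
with `e₁` open changes neither `Q` nor `u ∈ C₁` nor `o ∈ C₂` in either copy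
(`pairCount_fold_pendantB`, `tb14_slack_pendantB`); an UNMARKED leaf is a spectator: its free edge
doubles the folded count at the smaller profile (`pairCount_fold_spectatorLeaf`).
Axioms: standard.
-/

namespace Summit.Ventures.PercRepro2

namespace TB14Fold

open CovForm A3InactiveTyped

section PendantB

variable {V : Type} {E : Type} [Fintype E] [DecidableEq E] {R : Type*} [Field R]

omit [Fintype E] in
/-- The folded `b`-term of a first copy with the leaf edge open is the folded `u`-term of the
closed-leaf configuration at the smaller profile; with the leaf edge closed it vanishes. -/
lemma fold_leafB (ends : E → Sym2 V) (a₁ a₂ b u o : V) (F : Finset E) (e₁ : E)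
    (h₁ : ends e₁ = s(u, b)) (hleaf : ∀ e, b ∈ ends e → e = e₁) (hb1 : b ≠ a₁) (hb2 : b ≠ a₂)
    (hbo : b ≠ o) (hbu : b ≠ u) (y : Config E) :
    (foldBO ends a₁ a₂ b o y (A3InactiveTyped.flipOn F y) : R) =
      if y e₁ = true then
        foldBO ends a₁ a₂ u o (closeLeaf e₁ y) (A3InactiveTyped.flipOn (F.erase e₁) (closeLeaf e₁ y))
      else 0 := by
  set y₀ := closeLeaf e₁ y with hy₀
  set w := A3InactiveTyped.flipOn F y with hw
  have hagree_y : ∀ e, e ≠ e₁ → y₀ e = y e := fun e he => closeLeaf_of_ne he y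
  have hw₀ : A3InactiveTyped.flipOn (F.erase e₁) y₀ = closeLeaf e₁ w := flip_erase_closeLeaf F e₁ y
  have hagree_w : ∀ e, e ≠ e₁ → closeLeaf e₁ w e = w e := fun e he => closeLeaf_of_ne he w
  -- `b ∈ C₁(y)` iff the leaf edge is open and `u ∈ C₁(y)`
  have hA : Conn ends y a₁ b ↔ (y e₁ = true ∧ Conn ends y a₁ u) :=
    conn_leaf_at_iff h₁ hleaf hb1 y
  by_cases hy : y e₁ = true
  · rw [if_pos hy]
    have hQy : (iQ ends a₁ a₂ y₀ : R) = iQ ends a₁ a₂ y :=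
      iQ_congr (conn_leaf_agree_iff h₁ hleaf hagree_y hb2.symm hb1.symm)
    have hQw : (iQ ends a₁ a₂ (closeLeaf e₁ w) : R) = iQ ends a₁ a₂ w :=
      iQ_congr (conn_leaf_agree_iff h₁ hleaf hagree_w hb2.symm hb1.symm)
    have hBy : (iH ends a₂ o y₀ : R) = iH ends a₂ o y :=
      iH_congr (conn_leaf_agree_iff h₁ hleaf hagree_y hb2.symm hbo.symm)
    have hBw : (iH ends a₂ o (closeLeaf e₁ w) : R) = iH ends a₂ o w :=
      iH_congr (conn_leaf_agree_iff h₁ hleaf hagree_w hb2.symm hbo.symm)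
    have hAy : (iL ends a₁ b y : R) = iL ends a₁ u y₀ := by
      rw [iL_eq_ite, iL_eq_ite]
      have : Conn ends y a₁ b ↔ Conn ends y₀ a₁ u := by
        rw [hA]
        constructor
        · rintro ⟨_, h⟩; exact (conn_leaf_agree_iff h₁ hleaf hagree_y hb1.symm hbu.symm).2 h
        · intro h; exact ⟨hy, (conn_leaf_agree_iff h₁ hleaf hagree_y hb1.symm hbu.symm).1 h⟩
      by_cases hc : Conn ends y a₁ b
      · rw [if_pos hc, if_pos (this.1 hc)]
      · rw [if_neg hc, if_neg (fun hc' => hc (this.2 hc'))]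
    simp only [foldBO, hw₀, hQy, hQw, hBy, hBw, hAy]
  · rw [if_neg hy]
    have : (iL ends a₁ b y : R) = 0 := by
      rw [iL_eq_ite, if_neg]
      intro h
      exact hy (hA.1 h).1
    simp only [foldBO, this]; ring

/-- **The pendant rule for the folded (TB14) count, mark `b`**: with `b` a leaf at `u` through the
free edge `e₁`, the folded count for `(b, o)` at `(F, z)` is the folded count for `(u, o)` at
`(F ∖ {e₁}, z[e₁ ↦ closed])`. -/
theorem pairCount_fold_pendantB (ends : E → Sym2 V) (a₁ a₂ b u o : V) (F : Finset E)
    (z : Config E) (e₁ : E) (h₁ : ends e₁ = s(u, b)) (hleaf : ∀ e, b ∈ ends e → e = e₁)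
    (hb1 : b ≠ a₁) (hb2 : b ≠ a₂) (hbo : b ≠ o) (hbu : b ≠ u) (hF : e₁ ∈ F) :
    pairCount F z (foldBO ends a₁ a₂ b o : Config E → Config E → R) =
      pairCount (F.erase e₁) (closeLeaf e₁ z) (foldBO ends a₁ a₂ u o) := by
  unfold pairCount
  have hL := sum_split_toggle e₁ (fun y : Config E => if (∀ e, e ∉ F → y e = z e) then
    (foldBO ends a₁ a₂ b o y (A3InactiveTyped.flipOn F y) : R) else 0)
  have hR := sum_split_toggle e₁ (fun y : Config E =>
    if (∀ e, e ∉ F.erase e₁ → y e = closeLeaf e₁ z e) then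
      (foldBO ends a₁ a₂ u o y (A3InactiveTyped.flipOn (F.erase e₁) y) : R) else 0)
  rw [hL, hR]
  refine Finset.sum_congr rfl fun y _ => ?_
  by_cases hy : y e₁ = true
  · rw [if_pos hy, if_pos hy]
    have hτy : A3InactiveTyped.flipOn {e₁} y = closeLeaf e₁ y := by
      funext e
      by_cases he : e = e₁
      · subst he; simp [A3InactiveTyped.flipOn, closeLeaf, hy]
      · simp [A3InactiveTyped.flipOn, closeLeaf, he]
    rw [hτy]
    have hadmF : (∀ e, e ∉ F → closeLeaf e₁ y e = z e) ↔ (∀ e, e ∉ F → y e = z e) := by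
      constructor
      · intro h e he
        have hne : e ≠ e₁ := fun h' => he (by rw [h']; exact hF)
        rw [← closeLeaf_of_ne hne y]; exact h e he
      · intro h e he
        have hne : e ≠ e₁ := fun h' => he (by rw [h']; exact hF)
        rw [closeLeaf_of_ne hne y]; exact h e he
    have hadm1 : ¬ (∀ e, e ∉ F.erase e₁ → y e = closeLeaf e₁ z e) := by
      intro h
      have := h e₁ (Finset.notMem_erase e₁ F)
      rw [closeLeaf_self, hy] at this
      exact Bool.true_eq_false.mp this
    have hadm2 : (∀ e, e ∉ F.erase e₁ → closeLeaf e₁ y e = closeLeaf e₁ z e) ↔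
        (∀ e, e ∉ F → y e = z e) := by
      constructor
      · intro h e he
        have he' : e ∉ F.erase e₁ := fun h' => he (Finset.mem_of_mem_erase h')
        have hne : e ≠ e₁ := fun h' => he (by rw [h']; exact hF)
        have := h e he'
        rwa [closeLeaf_of_ne hne, closeLeaf_of_ne hne] at this
      · intro h e he
        by_cases hne : e = e₁
        · subst hne; rw [closeLeaf_self, closeLeaf_self]
        · have : e ∉ F := fun h' => he (Finset.mem_erase.2 ⟨hne, h'⟩)
          rw [closeLeaf_of_ne hne, closeLeaf_of_ne hne]; exact h e this
    rw [if_neg hadm1, zero_add]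
    simp only [hadmF, hadm2]
    split_ifs with hadm
    · -- the open-leaf term is the `u`-term of the closed configuration; the closed-leaf term is 0
      have h1 := fold_leafB (R := R) ends a₁ a₂ b u o F e₁ h₁ hleaf hb1 hb2 hbo hbu y
      have h2 := fold_leafB (R := R) ends a₁ a₂ b u o F e₁ h₁ hleaf hb1 hb2 hbo hbu (closeLeaf e₁ y)
      rw [if_pos hy] at h1
      rw [if_neg (by rw [closeLeaf_self]; exact Bool.false_ne_true)] at h2
      rw [h1, h2, add_zero]
    · simp
  · rw [if_neg hy, if_neg hy]

/-- **The pendant rule for (TB14), mark `b`**: the (TB14) slack for `(b, o)` at `(F, z)` is the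
slack for `(u, o)` at `(F ∖ {e₁}, z[e₁ ↦ closed])` when `b` is a leaf at `u` through the free
edge `e₁`. -/
theorem tb14_slack_pendantB (ends : E → Sym2 V) (a₁ a₂ b u o : V) (F : Finset E) (z : Config E)
    (e₁ : E) (h₁ : ends e₁ = s(u, b)) (hleaf : ∀ e, b ∈ ends e → e = e₁) (hb1 : b ≠ a₁)
    (hb2 : b ≠ a₂) (hbo : b ≠ o) (hbu : b ≠ u) (hF : e₁ ∈ F) :
    pairCount F z (sameBO ends a₁ a₂ b o : Config E → Config E → R) -
        pairCount F z (crossBO ends a₁ a₂ b o) =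
      pairCount (F.erase e₁) (closeLeaf e₁ z) (sameBO ends a₁ a₂ u o) -
        pairCount (F.erase e₁) (closeLeaf e₁ z) (crossBO ends a₁ a₂ u o) := by
  rw [pairCount_fold, pairCount_fold]
  exact pairCount_fold_pendantB ends a₁ a₂ b u o F z e₁ h₁ hleaf hb1 hb2 hbo hbu hF

/-- **An unmarked leaf is a spectator**: if `u ∉ {a₁, a₂, b, o}` has the single edge `e₁ ∈ F`, the
folded count at `(F, z)` is twice the folded count at `(F ∖ {e₁}, z[e₁ ↦ closed])`. -/
theorem pairCount_fold_spectatorLeaf (ends : E → Sym2 V) (a₁ a₂ b o u v : V) (F : Finset E)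
    (z : Config E) (e₁ : E) (h₁ : ends e₁ = s(v, u)) (hleaf : ∀ e, u ∈ ends e → e = e₁)
    (hu1 : u ≠ a₁) (hu2 : u ≠ a₂) (hub : u ≠ b) (huo : u ≠ o) (hF : e₁ ∈ F) :
    pairCount F z (foldBO ends a₁ a₂ b o : Config E → Config E → R) =
      2 * pairCount (F.erase e₁) (closeLeaf e₁ z) (foldBO ends a₁ a₂ b o) := by
  unfold pairCount
  rw [Finset.mul_sum]
  have hL := sum_split_toggle e₁ (fun y : Config E => if (∀ e, e ∉ F → y e = z e) then
    (foldBO ends a₁ a₂ b o y (A3InactiveTyped.flipOn F y) : R) else 0)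
  have hR := sum_split_toggle e₁ (fun y : Config E =>
    2 * (if (∀ e, e ∉ F.erase e₁ → y e = closeLeaf e₁ z e) then
      (foldBO ends a₁ a₂ b o y (A3InactiveTyped.flipOn (F.erase e₁) y) : R) else 0))
  rw [hL, hR]
  refine Finset.sum_congr rfl fun y _ => ?_
  by_cases hy : y e₁ = true
  · rw [if_pos hy, if_pos hy]
    have hτy : A3InactiveTyped.flipOn {e₁} y = closeLeaf e₁ y := by
      funext e
      by_cases he : e = e₁
      · subst he; simp [A3InactiveTyped.flipOn, closeLeaf, hy]
      · simp [A3InactiveTyped.flipOn, closeLeaf, he]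
    rw [hτy]
    have hadmF : (∀ e, e ∉ F → closeLeaf e₁ y e = z e) ↔ (∀ e, e ∉ F → y e = z e) := by
      constructor
      · intro h e he
        have hne : e ≠ e₁ := fun h' => he (by rw [h']; exact hF)
        rw [← closeLeaf_of_ne hne y]; exact h e he
      · intro h e he
        have hne : e ≠ e₁ := fun h' => he (by rw [h']; exact hF)
        rw [closeLeaf_of_ne hne y]; exact h e he
    have hadm1 : ¬ (∀ e, e ∉ F.erase e₁ → y e = closeLeaf e₁ z e) := by
      intro h
      have := h e₁ (Finset.notMem_erase e₁ F)
      rw [closeLeaf_self, hy] at this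
      exact Bool.true_eq_false.mp this
    have hadm2 : (∀ e, e ∉ F.erase e₁ → closeLeaf e₁ y e = closeLeaf e₁ z e) ↔
        (∀ e, e ∉ F → y e = z e) := by
      constructor
      · intro h e he
        have he' : e ∉ F.erase e₁ := fun h' => he (Finset.mem_of_mem_erase h')
        have hne : e ≠ e₁ := fun h' => he (by rw [h']; exact hF)
        have := h e he'
        rwa [closeLeaf_of_ne hne, closeLeaf_of_ne hne] at this
      · intro h e he
        by_cases hne : e = e₁
        · subst hne; rw [closeLeaf_self, closeLeaf_self]
        · have : e ∉ F := fun h' => he (Finset.mem_erase.2 ⟨hne, h'⟩)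
          rw [closeLeaf_of_ne hne, closeLeaf_of_ne hne]; exact h e this
    rw [if_neg hadm1, mul_zero, zero_add]
    simp only [hadmF, hadm2]
    split_ifs with hadm
    · -- all three folded terms agree: no event sees the spectator edge
      set y₀ := closeLeaf e₁ y with hy₀
      have hagree_y : ∀ e, e ≠ e₁ → y₀ e = y e := fun e he => closeLeaf_of_ne he y
      have hw₀ : A3InactiveTyped.flipOn (F.erase e₁) y₀ =
          closeLeaf e₁ (A3InactiveTyped.flipOn F y) := flip_erase_closeLeaf F e₁ y
      have hagree_w : ∀ e, e ≠ e₁ → closeLeaf e₁ (A3InactiveTyped.flipOn F y) e =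
          A3InactiveTyped.flipOn F y e := fun e he => closeLeaf_of_ne he _
      have hagree_w' : ∀ e, e ≠ e₁ → A3InactiveTyped.flipOn F y₀ e = A3InactiveTyped.flipOn F y e := by
        intro e he; simp only [A3InactiveTyped.flipOn, hagree_y e he]
      have e1 : (foldBO ends a₁ a₂ b o y₀ (A3InactiveTyped.flipOn F y₀) : R) =
          foldBO ends a₁ a₂ b o y (A3InactiveTyped.flipOn F y) := by
        simp only [foldBO]
        rw [iQ_congr (conn_leaf_agree_iff h₁ hleaf hagree_y hu2.symm hu1.symm),
          iQ_congr (conn_leaf_agree_iff h₁ hleaf hagree_w' hu2.symm hu1.symm),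
          iL_congr (conn_leaf_agree_iff h₁ hleaf hagree_y hu1.symm hub.symm),
          iH_congr (conn_leaf_agree_iff h₁ hleaf hagree_y hu2.symm huo.symm),
          iH_congr (conn_leaf_agree_iff h₁ hleaf hagree_w' hu2.symm huo.symm)]
      have e2 : (foldBO ends a₁ a₂ b o y₀ (A3InactiveTyped.flipOn (F.erase e₁) y₀) : R) =
          foldBO ends a₁ a₂ b o y (A3InactiveTyped.flipOn F y) := by
        rw [hw₀]
        simp only [foldBO]
        rw [iQ_congr (conn_leaf_agree_iff h₁ hleaf hagree_y hu2.symm hu1.symm),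
          iQ_congr (conn_leaf_agree_iff h₁ hleaf hagree_w hu2.symm hu1.symm),
          iL_congr (conn_leaf_agree_iff h₁ hleaf hagree_y hu1.symm hub.symm),
          iH_congr (conn_leaf_agree_iff h₁ hleaf hagree_y hu2.symm huo.symm),
          iH_congr (conn_leaf_agree_iff h₁ hleaf hagree_w hu2.symm huo.symm)]
      rw [e1, e2]; ring
    · simp
  · rw [if_neg hy, if_neg hy]

end PendantB

end TB14Fold

end Summit.Ventures.PercRepro2
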